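import Literature.NumberTheory.EllipticCurves.FineSelmerMuRoadDoors
import Literature.NumberTheory.NumberFields.ClassGroupNormGalois
import HarnessLib

/-!
# `p ∤ h(L)` for a Galois number field `L` from `p ∤ h` of TWO index-2 subfields cut out by involutions
# `b`, `z = b·(g b g⁻¹)` — and the GRH-free form of the Iwasawa-1956 door for `L = ℚ(E[p])`

Topic `NumberTheory/EllipticCurves` (the application) over a number-field lemma (§§1–2).  THEOREM-ONLY
file: no definition, no named fact, no `sorry`.  Written by the literature seat `bsd-potss-conjA-anchor`
g8 (cell `bsd-potss`, rungs K9/KT of `BirchSwinnertonDyer`; `--supports` stmt-19942; closes nothing).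

WHY.  The seat's `p = 3` census (kit j290399 + j289900) reaches statement (A) on 273 U₀-Cartan rows
through the Iwasawa-1956 door (`CartanMuRoadDoors.conjA_of_not_dvd_classNumber_of_unique_prime`, tree
p573777): `3 ∤ h(ℚ(W[3]))` and ONE prime above `3`.  The class number of the degree-16 field `ℚ(W[3])`
is known under GRH only (PARI `bnfinit`; `bnfcertify` at degree 16 rarely terminates), whereas the
class numbers of the degree-8 subfields `ℚ(P)` (one `3`-torsion point) and `ℚ(x(W[3]))` certify in
seconds (j289900: 399/399).  This file proves, in the kernel and with no representation theory, that the
two degree-8 class numbers suffice.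

## The lemma (folklore; the `p ∤ #G` descent of `p`-parts of class groups along a Brauer-type
## configuration, here in an elementary involution form)

Let `L/F` be a finite Galois extension of number fields, `p` an odd prime, and `b, g ∈ G = Gal(L/F)` with
`b² = 1`; put `z = b · (g b g⁻¹)` and assume `z² = 1`.  If `p ∤ h(L^{⟨b⟩})` and `p ∤ h(L^{⟨z⟩})` then
`p ∤ h(L)`.  Proof: for an involution `s` with `p ∤ h(L^{⟨s⟩})` and a class `c` with `c^p = 1`, the class
`c · s(c)` is `Gal(L/L^{⟨s⟩})`-invariant and `p`-torsion, so by Neukirch III (1.6)(iv) on classes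
(`(c·s(c))^{[L:L^{⟨s⟩}]} = i(N(c·s(c)))`, tree `pow_finrank_eq_classGroupExtend_classGroupNorm_of_forall_smul_eq`)
and `p ∤ h(L^{⟨s⟩})`, `p ∤ [L:L^{⟨s⟩}] ∈ {1,2}` it is trivial: `s(c) = c⁻¹` (§1).  Hence `b`, `g b g⁻¹`
and `z` all act by inversion on the `p`-torsion of `Cl(L)`; but `z = b·(g b g⁻¹)` then acts trivially,
so `c = c⁻¹`, `c² = 1 = c^p`, `c = 1`: `Cl(L)` has no element of order `p` (§2).
For `L = ℚ(E[p])` with `ρ̄(G_ℚ)` the normaliser of a Cartan subgroup at `p = 3` (`G ≅ D₄` or `SD₁₆`):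
`b` = the involution fixing a point `P` (so `L^{⟨b⟩} = ℚ(P)`), `z = −1` (so `L^{⟨z⟩} = ℚ(x(E[3]))`),
and `−1 = b · (g b g⁻¹)` with `g = a` resp. `a²` (§3 displays these as identities of the Galois action
on `E[p]`, checkable on the mod-`p` image).

## Main results

* §1 `classGroup_eq_one_of_pow_eq_one_of_forall_galois` — `L/K` Galois, `p ∤ h_K`, `p ∤ [L:K]`:
  a `Gal(L/K)`-invariant class of `L` with `c^p = 1` is trivial.
* §1 `galois_inv_of_involution` — an involution `s ∈ Gal(L/F)` with `p ∤ h(L^{⟨s⟩})`, `p ≠ 2`, inverts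
  every `p`-torsion class of `L`.
* §2 `not_dvd_classNumber_of_involutions` — the lemma above.
* §3 `WeierstrassCurve.not_dvd_classNumber_divisionField_of_involutions` — `L = ℚ(W[p])`, hypotheses
  = identities of the `Γ_ℚ`-action on `W[p]` + two class numbers of fixed fields; and the GRH-free
  Iwasawa-1956 door `CoatesSujatha2005.fineSelmerDual_moduleFinite_of_unique_prime_of_involutions`.

References: [NeukirchANT1999] Ch. III §1 Prop. (1.6) (ii), (iv); [Washington1997] §10.1 (`p ∤ [L:K]`
descent of `p`-parts); [Greenberg2001IwasawaPastPresent] Prop. 2.1; [CoatesSujatha2005] Thm. 3.4.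
-/

noncomputable section

open scoped Classical NumberField nonZeroDivisors

namespace Literature.NumberTheory.NumberFields.ClassNumberInvolutionDescent

open IsDedekindDomain Literature.NumberTheory.NumberFields

/-! ### §1 Invariant `p`-torsion classes over a base with `p ∤ h_K`, `p ∤ [L:K]` -/

/-- **An invariant `p`-torsion class is trivial** (`L/K` Galois, `p ∤ h_K`, `p ∤ [L:K]`): if
`c ∈ Cl(L)` satisfies `c^p = 1` and `σ c = c` for all `σ ∈ Gal(L/K)`, then `c = 1` — from
`c^{[L:K]} = i_{L/K}(N_{L/K} c)` (Neukirch III (1.6)(iv) on classes) and `(N c)^p = 1` in `Cl(K)`.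
[cite: NeukirchANT1999, Ch. III §1 Prop. (1.6) (iv)] [cite: Washington1997, §10.1] -/
theorem classGroup_eq_one_of_pow_eq_one_of_forall_galois (K L : Type) [Field K] [NumberField K]
    [Field L] [NumberField L] [Algebra K L] [IsGalois K L] {p : ℕ} (hp : p.Prime)
    (hK : ¬ p ∣ NumberField.classNumber K) (hKL : ¬ p ∣ Module.finrank K L) {c : ClassGroup (𝓞 L)}
    (hc : c ^ p = 1) (hfix : ∀ σ : L ≃ₐ[K] L, ClassGroup.mulEquiv (AmbiguousClass.intAut σ) c = c) :
    c = 1 := by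
  have h1 := pow_finrank_eq_classGroupExtend_classGroupNorm_of_forall_smul_eq K L hfix
  have hN : classGroupNorm K L c = 1 := by
    have hNp : classGroupNorm K L c ^ p = 1 := by rw [← map_pow, hc, map_one]
    have hord : orderOf (classGroupNorm K L c) ∣ p := orderOf_dvd_of_pow_eq_one hNp
    rcases (Nat.dvd_prime hp).mp hord with h | h
    · exact orderOf_eq_one_iff.mp h
    · exfalso; apply hK
      rw [NumberField.classNumber, ← h]
      exact orderOf_dvd_card
  rw [hN, map_one] at h1
  have hcop : Nat.Coprime p (Module.finrank K L) := (Nat.Prime.coprime_iff_not_dvd hp).mpr hKL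
  have := pow_gcd_eq_one.mpr ⟨hc, h1⟩
  rwa [Nat.Coprime.gcd_eq_one hcop, pow_one] at this

/-- The subgroup generated by an involution consists of `1` and the involution. [folklore] -/
private theorem mem_zpowers_of_mul_self_eq_one {G : Type*} [Group G] {s x : G} (hs : s * s = 1)
    (hx : x ∈ Subgroup.zpowers s) : x = 1 ∨ x = s := by
  obtain ⟨k, rfl⟩ := Subgroup.mem_zpowers_iff.mp hx
  have hs2 : s ^ (2 : ℤ) = 1 := by rw [zpow_two]; exact hs
  obtain ⟨m, rfl | rfl⟩ := Int.even_or_odd' k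
  · left; rw [zpow_mul, hs2, one_zpow]
  · right; rw [zpow_add, zpow_mul, hs2, one_zpow, one_mul, zpow_one]

/-- **An involution of `Gal(L/F)` whose fixed field has class number prime to `p` (`p` odd) inverts
every `p`-torsion class of `L`**: `s(c) = c⁻¹` whenever `c^p = 1` — apply
`classGroup_eq_one_of_pow_eq_one_of_forall_galois` over `K = L^{⟨s⟩}` (`[L:K] = #⟨s⟩ ∈ {1,2}`) to the
invariant class `c · s(c)`. [cite: NeukirchANT1999, Ch. III §1 Prop. (1.6) (iv)] [cite: Washington1997, §10.1] -/
theorem galois_inv_of_involution (F L : Type) [Field F] [NumberField F] [Field L] [NumberField L]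
    [Algebra F L] [IsGalois F L] {p : ℕ} (hp : p.Prime) (hp2 : p ≠ 2) (s : L ≃ₐ[F] L)
    (hs : s * s = 1)
    (hK : ¬ p ∣ NumberField.classNumber (IntermediateField.fixedField (Subgroup.zpowers s)))
    {c : ClassGroup (𝓞 L)} (hc : c ^ p = 1) :
    ClassGroup.mulEquiv (AmbiguousClass.intAut s) c = c⁻¹ := by
  set K := IntermediateField.fixedField (Subgroup.zpowers s) with hKdef
  -- `[L : K] = #⟨s⟩ ∣ 2`, so `p ∤ [L:K]`
  have hKL : ¬ p ∣ Module.finrank K L := by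
    intro h
    rw [hKdef, IntermediateField.finrank_fixedField_eq_card, Nat.card_zpowers] at h
    have h2 : orderOf s ∣ 2 := orderOf_dvd_of_pow_eq_one (by rw [pow_two]; exact hs)
    exact hp2 ((Nat.prime_dvd_prime_iff_eq hp Nat.prime_two).mp (dvd_trans h h2))
  -- every `σ ∈ Gal(L/K)` restricts to `1` or `s`
  have hres : ∀ σ : L ≃ₐ[K] L, σ.restrictScalars F = 1 ∨ σ.restrictScalars F = s := by
    intro σ
    apply mem_zpowers_of_mul_self_eq_one hs
    rw [← IntermediateField.fixingSubgroup_fixedField (Subgroup.zpowers s)]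
    intro x
    exact σ.commutes x
  -- the invariant class `u = c · s(c)`
  set u := c * ClassGroup.mulEquiv (AmbiguousClass.intAut s) c with hu
  have hup : u ^ p = 1 := by rw [hu, mul_pow, ← map_pow, hc, map_one, mul_one]
  have hsu : ClassGroup.mulEquiv (AmbiguousClass.intAut s) u = u := by
    rw [hu, map_mul, ← MulEquiv.trans_apply, ← AmbiguousClass.mulEquiv_intAut_mul, hs,
      AmbiguousClass.mulEquiv_intAut_one, MulEquiv.refl_apply, mul_comm]
  have hfix : ∀ σ : L ≃ₐ[K] L, ClassGroup.mulEquiv (AmbiguousClass.intAut σ) u = u := by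
    intro σ
    have key : AmbiguousClass.intAut σ = AmbiguousClass.intAut (σ.restrictScalars F) := rfl
    rcases hres σ with h | h
    · rw [key, h, AmbiguousClass.mulEquiv_intAut_one, MulEquiv.refl_apply]
    · rw [key, h, hsu]
  have hu1 : u = 1 := classGroup_eq_one_of_pow_eq_one_of_forall_galois K L hp hK hKL hup hfix
  rw [hu] at hu1
  exact eq_inv_of_mul_eq_one_right hu1

/-! ### §2 Two involutions `b`, `z = b·(g b g⁻¹)` with `p ∤ h` of their fixed fields force `p ∤ h(L)` -/

/-- **`p ∤ h(L)` from two index-≤2 subfields.**  `L/F` Galois number fields, `p` an odd prime,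
`b, g ∈ Gal(L/F)` with `b² = 1`, `z := b·(g b g⁻¹)` with `z² = 1`; if `p ∤ h(L^{⟨b⟩})` and `p ∤ h(L^{⟨z⟩})`
then `p ∤ h(L)`: `b`, `g b g⁻¹` and `z` invert the `p`-torsion classes (§1), and `z = b·(g b g⁻¹)` fixes
them, so they are `2`-torsion, hence trivial. [cite: NeukirchANT1999, Ch. III §1 Prop. (1.6) (iv)]
[cite: Washington1997, §10.1] -/
theorem not_dvd_classNumber_of_involutions (F L : Type) [Field F] [NumberField F] [Field L]
    [NumberField L] [Algebra F L] [IsGalois F L] {p : ℕ} (hp : p.Prime) (hp2 : p ≠ 2)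
    (b g z : L ≃ₐ[F] L) (hb : b * b = 1) (hz : z * z = 1) (hrel : z = b * (g * b * g⁻¹))
    (hKb : ¬ p ∣ NumberField.classNumber (IntermediateField.fixedField (Subgroup.zpowers b)))
    (hKz : ¬ p ∣ NumberField.classNumber (IntermediateField.fixedField (Subgroup.zpowers z))) :
    ¬ p ∣ NumberField.classNumber L := by
  intro hdiv
  haveI : Fact p.Prime := ⟨hp⟩
  -- a class of order `p`
  obtain ⟨c, hc⟩ := exists_prime_orderOf_dvd_card' (G := ClassGroup (𝓞 L)) p
    (by rwa [NumberField.classNumber, ← Nat.card_eq_fintype_card] at hdiv)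
  have hcp : c ^ p = 1 := by rw [← hc]; exact pow_orderOf_eq_one c
  -- notation for the action
  let act : (L ≃ₐ[F] L) → ClassGroup (𝓞 L) ≃* ClassGroup (𝓞 L) :=
    fun σ => ClassGroup.mulEquiv (AmbiguousClass.intAut σ)
  have act_mul : ∀ σ τ (d : ClassGroup (𝓞 L)), act (σ * τ) d = act σ (act τ d) := by
    intro σ τ d
    change ClassGroup.mulEquiv (AmbiguousClass.intAut (σ * τ)) d = _
    rw [AmbiguousClass.mulEquiv_intAut_mul, MulEquiv.trans_apply]
  have act_one : ∀ d : ClassGroup (𝓞 L), act 1 d = d := by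
    intro d
    change ClassGroup.mulEquiv (AmbiguousClass.intAut (1 : L ≃ₐ[F] L)) d = d
    rw [AmbiguousClass.mulEquiv_intAut_one, MulEquiv.refl_apply]
  -- `b`, `z` invert `p`-torsion classes
  have hb_inv : ∀ d : ClassGroup (𝓞 L), d ^ p = 1 → act b d = d⁻¹ :=
    fun d hd => galois_inv_of_involution F L hp hp2 b hb hKb hd
  have hz_inv : act z c = c⁻¹ := galois_inv_of_involution F L hp hp2 z hz hKz hcp
  -- the conjugate `g b g⁻¹` inverts them too
  have hgbg : act (g * b * g⁻¹) c = c⁻¹ := by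
    have h1 : (act g⁻¹ c) ^ p = 1 := by rw [← map_pow, hcp, map_one]
    rw [act_mul, act_mul, hb_inv _ h1, map_inv, ← act_mul, mul_inv_cancel, act_one]
  -- hence `z` fixes `c`
  have hzc : act z c = c := by
    have h1 : (c⁻¹) ^ p = 1 := by rw [inv_pow, hcp, inv_one]
    rw [hrel, act_mul, hgbg, hb_inv _ h1, inv_inv]
  -- so `c = c⁻¹`, `c² = 1`, contradiction with `orderOf c = p` odd prime
  rw [hzc] at hz_inv
  have hc2 : c ^ 2 = 1 := by rw [pow_two]; nth_rw 2 [hz_inv]; exact mul_inv_cancel c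
  have hdvd : orderOf c ∣ 2 := orderOf_dvd_of_pow_eq_one hc2
  rw [hc] at hdvd
  exact hp2 ((Nat.prime_dvd_prime_iff_eq hp Nat.prime_two).mp hdvd)

end Literature.NumberTheory.NumberFields.ClassNumberInvolutionDescent

/-! ### §3 The division field `ℚ(W[p])`: hypotheses as identities of the Galois action on `W[p]` -/

namespace Literature.NumberTheory.EllipticCurves

namespace DivisionField

open WeierstrassCurve Literature.NumberTheory.EllipticCurves Literature.NumberTheory.GaloisRepresentations
open Field Literature.NumberTheory.NumberFields.ClassNumberInvolutionDescent

/-- **`p ∤ h(ℚ(W[p]))` from the class numbers of two index-2 subfields**, the configuration displayed on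
the `p`-torsion: `τ_b, τ_g, τ_z ∈ Γ_ℚ` with `τ_b², τ_z²` acting trivially on `W[p]` and
`τ_z = τ_b τ_g τ_b τ_g⁻¹` on `W[p]` (for `ρ̄(Γ_ℚ) = N(C)` Cartan normaliser at `p = 3`: `τ_b|_L = b` the
involution fixing a point `P`, `τ_z|_L = −1`, `τ_g|_L = a` (`D₄`) resp. `a²` (`SD₁₆`), so that the two
fixed fields are `ℚ(P)` and `ℚ(x(W[3]))`, both of degree 8); if `p` is odd and `p ∤ h` of the fixed
fields of `⟨τ_b|_L⟩` and `⟨τ_z|_L⟩`, then `p ∤ h(ℚ(W[p]))`.  (§2 with `F = ℚ`, `L = ℚ(W[p])`, the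
restrictions read through `absRestrictNormalHom_divisionField_eq_one_iff`.)
[cite: NeukirchANT1999, Ch. III §1 Prop. (1.6) (iv)] [cite: Washington1997, §10.1] -/
theorem not_dvd_classNumber_divisionField_of_involutions (W : WeierstrassCurve ℚ) [W.IsElliptic]
    (p : ℕ) [Fact p.Prime] (hp2 : p ≠ 2) (τb τg τz : absoluteGaloisGroup ℚ)
    (hb : haveI : NeZero p := ⟨(Fact.out : p.Prime).ne_zero⟩
      ∀ T : geomTorsion W (p : ℤ), τb • (τb • T) = T)
    (hz : haveI : NeZero p := ⟨(Fact.out : p.Prime).ne_zero⟩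
      ∀ T : geomTorsion W (p : ℤ), τz • (τz • T) = T)
    (hrel : haveI : NeZero p := ⟨(Fact.out : p.Prime).ne_zero⟩
      ∀ T : geomTorsion W (p : ℤ), τz • T = τb • (τg • (τb • (τg⁻¹ • T))))
    (hKb : haveI : NeZero p := ⟨(Fact.out : p.Prime).ne_zero⟩
      haveI : NumberField (W.divisionField p) := NumberField.mk
      ¬ p ∣ NumberField.classNumber (IntermediateField.fixedField
        (Subgroup.zpowers (absRestrictNormalHom (W.divisionField p) τb))))
    (hKz : haveI : NeZero p := ⟨(Fact.out : p.Prime).ne_zero⟩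
      haveI : NumberField (W.divisionField p) := NumberField.mk
      ¬ p ∣ NumberField.classNumber (IntermediateField.fixedField
        (Subgroup.zpowers (absRestrictNormalHom (W.divisionField p) τz)))) :
    haveI : NeZero p := ⟨(Fact.out : p.Prime).ne_zero⟩
    haveI : NumberField (W.divisionField p) := NumberField.mk
    ¬ p ∣ NumberField.classNumber (W.divisionField p) := by
  haveI : NeZero p := ⟨(Fact.out : p.Prime).ne_zero⟩
  haveI : NumberField (W.divisionField p) := NumberField.mk
  have hp : p.Prime := Fact.out
  have h1 : ∀ σ : absoluteGaloisGroup ℚ, absRestrictNormalHom (W.divisionField p) σ = 1 ↔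
      ∀ T : geomTorsion W (p : ℤ), σ • T = T :=
    fun σ => W.absRestrictNormalHom_divisionField_eq_one_iff p σ
  have hbb : absRestrictNormalHom (W.divisionField p) τb * absRestrictNormalHom (W.divisionField p) τb = 1 := by
    rw [← map_mul, h1]; intro T; rw [mul_smul]; exact hb T
  have hzz : absRestrictNormalHom (W.divisionField p) τz * absRestrictNormalHom (W.divisionField p) τz = 1 := by
    rw [← map_mul, h1]; intro T; rw [mul_smul]; exact hz T
  have hrel' : absRestrictNormalHom (W.divisionField p) τz =
      absRestrictNormalHom (W.divisionField p) τb * (absRestrictNormalHom (W.divisionField p) τg *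
        absRestrictNormalHom (W.divisionField p) τb * (absRestrictNormalHom (W.divisionField p) τg)⁻¹) := by
    have h2 : absRestrictNormalHom (W.divisionField p) (τz⁻¹ * (τb * (τg * τb * τg⁻¹))) = 1 := by
      rw [h1]; intro T
      rw [mul_smul, mul_smul, mul_smul, mul_smul, ← hrel T, ← mul_smul, inv_mul_cancel, one_smul]
    rw [map_mul, map_inv, inv_mul_eq_one] at h2
    rw [h2, map_mul, map_mul, map_mul, map_inv]
  exact @not_dvd_classNumber_of_involutions ℚ (W.divisionField p) _ _ _ _ (_)
    (W.isGalois_divisionField p) p hp hp2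
    (absRestrictNormalHom (W.divisionField p) τb) (absRestrictNormalHom (W.divisionField p) τg)
    (absRestrictNormalHom (W.divisionField p) τz) hbb hzz hrel' hKb hKz

end DivisionField

namespace CoatesSujatha2005

open WeierstrassCurve Literature.NumberTheory.EllipticCurves Literature.NumberTheory.GaloisRepresentations
open Literature.NumberTheory.IwasawaTheory Field IsDedekindDomain

/-- **The Iwasawa-1956 door, GRH-free form**: `fineSelmerDual_moduleFinite_of_not_dvd_classNumber_of_unique_prime`
(p572797) with its hypothesis `p ∤ h(ℚ(W[p]))` replaced by the involution certificate of
`DivisionField.not_dvd_classNumber_divisionField_of_involutions` — two class numbers of degree-8 fields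
(`p = 3`, Cartan normaliser image) instead of one of degree 16.  Granted the named facts Iwasawa 1956
(`hIw`) and Coates–Sujatha Thm. 3.4 (`hCS`); (A) is not asserted unconditionally.
[cite: Greenberg2001IwasawaPastPresent, Prop. 2.1 p. 339] [cite: CoatesSujatha2005, Thm. 3.4 (§3)] -/
theorem fineSelmerDual_moduleFinite_of_unique_prime_of_involutions
    (hIw : iwasawa1956_classNumberPExp_eq_zero_of_not_dvd_classNumber_of_unique_prime)
    (hCS : thm34_fineSelmerDual_moduleFinite_of_classicalMuVanishes_divisionField)
    (W : WeierstrassCurve ℚ) [W.IsElliptic] (p : ℕ) [Fact p.Prime] (hp2 : p ≠ 2)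
    (τb τg τz : absoluteGaloisGroup ℚ)
    (hb : haveI : NeZero p := ⟨(Fact.out : p.Prime).ne_zero⟩
      ∀ T : geomTorsion W (p : ℤ), τb • (τb • T) = T)
    (hz : haveI : NeZero p := ⟨(Fact.out : p.Prime).ne_zero⟩
      ∀ T : geomTorsion W (p : ℤ), τz • (τz • T) = T)
    (hrel : haveI : NeZero p := ⟨(Fact.out : p.Prime).ne_zero⟩
      ∀ T : geomTorsion W (p : ℤ), τz • T = τb • (τg • (τb • (τg⁻¹ • T))))
    (hKb : haveI : NeZero p := ⟨(Fact.out : p.Prime).ne_zero⟩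
      haveI : NumberField (W.divisionField p) := NumberField.mk
      ¬ p ∣ NumberField.classNumber (IntermediateField.fixedField
        (Subgroup.zpowers (absRestrictNormalHom (W.divisionField p) τb))))
    (hKz : haveI : NeZero p := ⟨(Fact.out : p.Prime).ne_zero⟩
      haveI : NumberField (W.divisionField p) := NumberField.mk
      ¬ p ∣ NumberField.classNumber (IntermediateField.fixedField
        (Subgroup.zpowers (absRestrictNormalHom (W.divisionField p) τz))))
    (hv : haveI : NeZero p := ⟨(Fact.out : p.Prime).ne_zero⟩
      haveI : NumberField (W.divisionField p) := NumberField.mk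
      ∃! v : HeightOneSpectrum (𝓞 (W.divisionField p)), ((p : ℕ) : 𝓞 (W.divisionField p)) ∈ v.asIdeal)
    (κ : ZpExtension ℚ p) (hκ : κ.IsCyclotomic) :
    ∃ (γ : Field.absoluteGaloisGroup ℚ) (D : W.FineSelmerDualData κ γ),
      Module.Finite ℤ_[p] (RestrictScalars ℤ_[p] (IwasawaAlgebra p) D.X) :=
  fineSelmerDual_moduleFinite_of_not_dvd_classNumber_of_unique_prime hIw hCS W p hp2
    (DivisionField.not_dvd_classNumber_divisionField_of_involutions W p hp2 τb τg τz hb hz hrel hKb hKz)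
    hv κ hκ

end CoatesSujatha2005

end Literature.NumberTheory.EllipticCurves

end
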